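import Summits.BirchSwinnertonDyer.BirchSwinnertonDyer.Theses.SignedLowerHalves
import Summits.BirchSwinnertonDyer.BirchSwinnertonDyer.Theorems.EisensteinPrimesHidaLimitFittingBoundConverse
import Literature.NumberTheory.EllipticCurves.CyclotomicIwasawaMainTheoremIrreducibleProofs
import Literature.NumberTheory.EllipticCurves.LeadingTermPPartProofs
import Literature.NumberTheory.EllipticCurves.Sprung2012.SharpFlatSelmerDualExistsProofs
import HarnessLib

/-!
# Negative lemmas for the crux `SprungLowerDivisibilityAtThree` (item stmt-BirchSwinnertonDyer-19875)

Supporting (load-bearing-hypothesis) lemmas from the disprover's work file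
`Cruxes/SprungLowerDivisibilityAtThree/Disproof.lean`; none asserts a Theses decl positively.

* `conclusion_false_of_chromaticL_eq_zero` — for EVERY dual datum `D` of `Sel^•(E/K_∞)` the conclusion shape of
  `Theorems.SprungSharpFlatLowerDivisibility` ("`char D.X = (gen)`, `ι gen = ϖ · ι(L^• · h)`") is FALSE at
  `L^• = 0` (`char ≠ ⊥`, `ι` injective): the guard `chromaticL • L♯ L♭ ≠ 0` is load-bearing;
  `chromaticL_ne_zero_of_guardFree` — the guard-free variant of the leaf implies non-vanishing of `L^•` for every
  admissible data tuple, i.e. Sprung 2017 Conj. 4.12 for the curve (open) — so no `_false_without_guard` exists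
  short
  of refuting that conjecture.
* `isTorsion_of_charIdeal_eq_span_of_constantCoeff_eq_zero` / `…_of_not_isUnit` — with the tree's junk convention
  `char(non-torsion) = ⊤` (`Theorems.charIdeal_eq_top_of_not_isTorsion`) the typed "lower half" FORCES `Λ`-torsion
  of `X` whenever `L(0) = 0`, resp. whenever `ϖ` is `p`-integral and `L` is a non-unit;
  `isTorsion_of_sprungLowerDivisibilityAtThree` — hence the crux contains Sprung 2012 Thm 7.14 (Kato) at every X8
  pair with `L^•(0) = 0`: any proof of it must import cotorsion (typed fact
  `Sprung2012.thm714_sharpFlatSelmerDual_finite_torsion`), although in print (char of a non-torsion module `:= 0`)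
  the Eisenstein half is trivially true there.
-/

set_option autoImplicit false
-- the problem directory `BirchSwinnertonDyer/BirchSwinnertonDyer` forces the duplicated namespace segment
set_option linter.dupNamespace false

noncomputable section

open scoped Classical NumberField MatrixGroups ModularForm

open NumberField IsDedekindDomain CongruenceSubgroup WeierstrassCurve
  Literature.NumberTheory.EllipticCurves Literature.NumberTheory.EllipticCurves.ModularForms
  Literature.NumberTheory.EllipticCurves.ZpExtension Literature.NumberTheory.EllipticCurves.Sprung2017
  Literature.NumberTheory.EllipticCurves.Sprung2012 Literature.NumberTheory.EllipticCurves.Rank1Residual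

namespace Summit.BirchSwinnertonDyer.BirchSwinnertonDyer.Theorems

universe u

variable {p : ℕ} [Fact p.Prime]

/-- **The guard `L^• ≠ 0` is load-bearing.** For EVERY dual datum `D` of `Sel^•(E/K_∞)` and every `ϖ`, the
conclusion of `SprungSharpFlatLowerDivisibility` with `L^• = 0` is FALSE: `char_Λ(D.X) ≠ ⊥`
(`Module.charIdeal_ne_bot`)
while `ι gen = ϖ · ι(0 · h) = 0` forces `gen = 0`. Hence the displayed hypothesis `chromaticL • L♯ L♭ ≠ 0` cannot be
dropped unless `L^•` never vanishes (Sprung 2017 Conj. 4.12, open). [folklore] -/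
theorem SprungLowerDivisibilityAtThreeNegative.conclusion_false_of_chromaticL_eq_zero {K : Type u} [Field K]
    [NumberField K] {W : WeierstrassCurve K} {κ : ZpExtension K p} {γ : Field.absoluteGaloisGroup K}
    {E : Type u} [Field E] [Algebra K E] {ι : AlgebraicClosure K →ₐ[K] AlgebraicClosure E} {ap : ℤ}
    {g : Field.absoluteGaloisGroup E} {c : ℕ → localPoints W E} {col : Chroma}
    (D : SharpFlatSelmerDualData W κ γ ι ap g c col) (ϖ : ℚ_[p]) {Lsharp Lflat : IwasawaAlgebra p}
    (h0 : chromaticL col Lsharp Lflat = 0) :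
    ¬ ∃ gen h : IwasawaAlgebra p, D.charIdeal = Ideal.span {gen} ∧
      iwasawaToPowerSeries p gen =
        PowerSeries.C ϖ * iwasawaToPowerSeries p (chromaticL col Lsharp Lflat * h) := by
  rintro ⟨gen, h, hI, hι⟩
  rw [h0, zero_mul, map_zero, mul_zero] at hι
  have hgen : gen = 0 := iwasawaToPowerSeries_injective p (by rw [hι, map_zero])
  exact Module.charIdeal_ne_bot (IwasawaAlgebra p) D.X
    (by rw [← SharpFlatSelmerDualData.charIdeal, hI, hgen, Ideal.span_singleton_eq_bot])

/-- **Dropping the guard adds Sprung 2017 Conj. 4.12.** If the leaf `SprungSharpFlatLowerDivisibility W p •` held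
WITHOUT its guard `chromaticL • L♯ L♭ ≠ 0` (hypothesis `hW`: all other binders verbatim), then for every admissible
data tuple (cyclotomic `(κ, γ)`, place, lift, Honda system, newform, period ratio, Sprung pair) `L^•` is NOT
identically zero — the dual datum exists unconditionally (`Sprung2012.nonempty_sharpFlatSelmerDualData_rat`) and at
`L^• = 0` the conclusion is false (`conclusion_false_of_chromaticL_eq_zero`). "Any proof must use the guard", short
of proving Conj. 4.12 ("`L^♭_p`, `L^♯_p` are not identically zero when `a_p ≠ 2`") for the curve.
[cite: Sprung2017, Conj. 4.12] -/
theorem SprungLowerDivisibilityAtThreeNegative.chromaticL_ne_zero_of_guardFree (W : WeierstrassCurve ℚ)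
    [W.IsElliptic] [W.IsGloballyMinimal] (p : ℕ) [Fact p.Prime] (col : Chroma)
    (hW : ∀ (κ : ZpExtension ℚ p) (γ : Field.absoluteGaloisGroup ℚ),
        κ.IsCyclotomic → κ.IsTopGenerator γ → IsCyclotomicVariable p γ →
      ∀ (v : HeightOneSpectrum (𝓞 ℚ)), (p : 𝓞 ℚ) ∈ v.asIdeal →
      ∀ (g : Field.absoluteGaloisGroup (v.adicCompletion ℚ)),
        κ.IsTopGenerator (resGalOfEmb (closureEmb (K := ℚ) (v.adicCompletion ℚ)) g) →
      ∀ (cneg : localPoints W (v.adicCompletion ℚ)) (c : ℕ → localPoints W (v.adicCompletion ℚ)),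
        IsHondaSystem κ (closureEmb (K := ℚ) (v.adicCompletion ℚ)) W (W.frobeniusTrace p) g cneg c →
      ∀ (N : ℕ) (_ : NeZero N) (f : CuspForm (Gamma0 N) 2) (ϖ : ℚ) (Lsharp Lflat : IwasawaAlgebra p),
        IsNewformOf W f → (ϖ : ℝ) * W.realPeriodRat = plusPeriod f →
        IsSprungPair f p (W.frobeniusTrace p) Lsharp Lflat →
      ∀ D : SharpFlatSelmerDualData W κ γ (closureEmb (K := ℚ) (v.adicCompletion ℚ))
          (W.frobeniusTrace p) g c col,
        ∃ gen h : IwasawaAlgebra p, D.charIdeal = Ideal.span {gen} ∧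
          iwasawaToPowerSeries p gen =
            PowerSeries.C (ϖ : ℚ_[p]) * iwasawaToPowerSeries p (chromaticL col Lsharp Lflat * h))
    (κ : ZpExtension ℚ p) (γ : Field.absoluteGaloisGroup ℚ) (hκ : κ.IsCyclotomic) (hγ : κ.IsTopGenerator γ)
    (hvar : IsCyclotomicVariable p γ) (v : HeightOneSpectrum (𝓞 ℚ)) (hv : (p : 𝓞 ℚ) ∈ v.asIdeal)
    (g : Field.absoluteGaloisGroup (v.adicCompletion ℚ))
    (hg : κ.IsTopGenerator (resGalOfEmb (closureEmb (K := ℚ) (v.adicCompletion ℚ)) g))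
    (cneg : localPoints W (v.adicCompletion ℚ)) (c : ℕ → localPoints W (v.adicCompletion ℚ))
    (hc : IsHondaSystem κ (closureEmb (K := ℚ) (v.adicCompletion ℚ)) W (W.frobeniusTrace p) g cneg c)
    (N : ℕ) (hN : NeZero N) (f : CuspForm (Gamma0 N) 2) (ϖ : ℚ) (Lsharp Lflat : IwasawaAlgebra p)
    (hf : IsNewformOf W f) (hϖ : (ϖ : ℝ) * W.realPeriodRat = plusPeriod f)
    (hL : IsSprungPair f p (W.frobeniusTrace p) Lsharp Lflat) :
    chromaticL col Lsharp Lflat ≠ 0 := by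
  intro h0
  obtain ⟨D⟩ := nonempty_sharpFlatSelmerDualData_rat W κ γ v g c col
  exact SprungLowerDivisibilityAtThreeNegative.conclusion_false_of_chromaticL_eq_zero D (ϖ : ℚ_[p]) h0
    (hW κ γ hκ hγ hvar v hv g hg cneg c hc N hN f ϖ Lsharp Lflat hf hϖ hL D)

/-- **Torsion smuggling, vanishing constant term.** If `char_Λ(X) = (gen)` with `ι gen = ϖ · ι(L · h)` and
`L(0) = 0`, then `X` is `Λ`-torsion: otherwise `char_Λ(X) = ⊤` (`Theorems.charIdeal_eq_top_of_not_isTorsion`),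
`gen` is a unit, but `gen(0) = ϖ · L(0) · h(0) = 0`. [folklore] -/
theorem SprungLowerDivisibilityAtThreeNegative.isTorsion_of_charIdeal_eq_span_of_constantCoeff_eq_zero
    (X : Type*) [AddCommGroup X] [Module (IwasawaAlgebra p) X] {gen L h : IwasawaAlgebra p} {ϖ : ℚ_[p]}
    (hI : Module.charIdeal (IwasawaAlgebra p) X = Ideal.span {gen})
    (hι : iwasawaToPowerSeries p gen = PowerSeries.C ϖ * iwasawaToPowerSeries p (L * h))
    (hL0 : PowerSeries.constantCoeff L = 0) :
    Module.IsTorsion (IwasawaAlgebra p) X := by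
  by_contra hX
  have htop := Theorems.charIdeal_eq_top_of_not_isTorsion (p := p) X hX
  rw [hI, Ideal.span_singleton_eq_top] at htop
  have hunit : IsUnit (PowerSeries.constantCoeff gen) := PowerSeries.isUnit_constantCoeff gen htop
  have h0 : ((PowerSeries.constantCoeff gen : ℤ_[p]) : ℚ_[p]) = 0 := by
    have := congrArg PowerSeries.constantCoeff hι
    simpa [map_mul, constantCoeff_iwasawaToPowerSeries, hL0] using this
  rw [PadicInt.coe_eq_zero] at h0
  rw [h0] at hunit
  exact not_isUnit_zero hunit

/-- **Torsion smuggling, general form.** If `char_Λ(X) = (gen)` with `ι gen = ϖ · ι(L · h)`, `ϖ` `p`-integral and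
`L` a NON-unit of `Λ` (i.e. `p ∣ L(0)`), then `X` is `Λ`-torsion. So for `ϖ ∈ ℤ_(p)` the typed lower divisibility
is equivalent to "(L unit) ∨ (X torsion ∧ ϖ·L ∣ char X)". [folklore] -/
theorem SprungLowerDivisibilityAtThreeNegative.isTorsion_of_charIdeal_eq_span_of_not_isUnit
    (X : Type*) [AddCommGroup X] [Module (IwasawaAlgebra p) X] {gen L h : IwasawaAlgebra p} {ϖ : ℚ_[p]}
    (hI : Module.charIdeal (IwasawaAlgebra p) X = Ideal.span {gen})
    (hι : iwasawaToPowerSeries p gen = PowerSeries.C ϖ * iwasawaToPowerSeries p (L * h))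
    (hϖ : ‖ϖ‖ ≤ 1) (hL : ¬ IsUnit L) :
    Module.IsTorsion (IwasawaAlgebra p) X := by
  by_contra hX
  have htop := Theorems.charIdeal_eq_top_of_not_isTorsion (p := p) X hX
  rw [hI, Ideal.span_singleton_eq_top] at htop
  have hx : ‖(PowerSeries.constantCoeff gen : ℤ_[p])‖ = 1 :=
    PadicInt.isUnit_iff.mp (PowerSeries.isUnit_constantCoeff gen htop)
  have hc : ((PowerSeries.constantCoeff gen : ℤ_[p]) : ℚ_[p]) =
      ϖ * (((PowerSeries.constantCoeff L : ℤ_[p]) : ℚ_[p]) * ((PowerSeries.constantCoeff h : ℤ_[p]) : ℚ_[p])) := by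
    have := congrArg PowerSeries.constantCoeff hι
    simpa [map_mul, constantCoeff_iwasawaToPowerSeries] using this
  have hn : (1 : ℝ) = ‖ϖ‖ * (‖(PowerSeries.constantCoeff L : ℤ_[p])‖ * ‖(PowerSeries.constantCoeff h : ℤ_[p])‖) := by
    rw [← hx, ← PadicInt.padic_norm_e_of_padicInt, hc, norm_mul, norm_mul, PadicInt.padic_norm_e_of_padicInt,
      PadicInt.padic_norm_e_of_padicInt]
  have hL1 : ‖(PowerSeries.constantCoeff L : ℤ_[p])‖ < 1 := by
    rcases (PadicInt.norm_le_one (PowerSeries.constantCoeff L : ℤ_[p])).lt_or_eq with hlt | heq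
    · exact hlt
    · exact absurd (PowerSeries.isUnit_iff_constantCoeff.mpr (PadicInt.isUnit_iff.mpr heq)) hL
  have hh1 : ‖(PowerSeries.constantCoeff h : ℤ_[p])‖ ≤ 1 := PadicInt.norm_le_one _
  set a := ‖ϖ‖ with ha
  set b := ‖(PowerSeries.constantCoeff L : ℤ_[p])‖ with hb
  set d := ‖(PowerSeries.constantCoeff h : ℤ_[p])‖ with hd
  have ha0 : 0 ≤ a := norm_nonneg _
  have hb0 : 0 ≤ b := norm_nonneg _
  have hd0 : 0 ≤ d := norm_nonneg _
  nlinarith [mul_nonneg (sub_nonneg.mpr hϖ) (mul_nonneg hb0 hd0), mul_nonneg (sub_nonneg.mpr hh1) hb0]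

/-- **The crux contains Thm 7.14 at every analytic zero.** `SprungLowerDivisibilityAtThree` implies: for every
X8 pair, every admissible data tuple and every dual datum `D`, if `L^•(0) = 0` (e.g. `L(E,1) = 0`, since
`L^•(0) = c_• · L(E,1)/Ω⁺`) then `X^•(E/ℚ_∞) = D.X` is `Λ`-torsion — the content of Sprung 2012 Thm 7.14 (Kato),
which a reader of "lower half" would not expect the statement to assert. (The typed leaf is therefore
"Thm 7.14-at-non-units ∧ printed Eisenstein half"; the extra conjunct is dischargeable by the typed fact
`Sprung2012.thm714_sharpFlatSelmerDual_finite_torsion`, so this is a proof obligation, not a misstatement.)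
[cite: Sprung2012, Thm. 7.14 (p. 1504)] -/
theorem SprungLowerDivisibilityAtThreeNegative.isTorsion_of_sprungLowerDivisibilityAtThree
    (hcrux : Theses.SignedLowerHalves.SprungLowerDivisibilityAtThree)
    (W : WeierstrassCurve ℚ) [W.IsElliptic] [W.IsGloballyMinimal] (p : ℕ) [Fact p.Prime]
    (hX8 : ClassX8 W p) (col : Chroma)
    (κ : ZpExtension ℚ p) (γ : Field.absoluteGaloisGroup ℚ) (hκ : κ.IsCyclotomic) (hγ : κ.IsTopGenerator γ)
    (hvar : IsCyclotomicVariable p γ) (v : HeightOneSpectrum (𝓞 ℚ)) (hv : (p : 𝓞 ℚ) ∈ v.asIdeal)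
    (g : Field.absoluteGaloisGroup (v.adicCompletion ℚ))
    (hg : κ.IsTopGenerator (resGalOfEmb (closureEmb (K := ℚ) (v.adicCompletion ℚ)) g))
    (cneg : localPoints W (v.adicCompletion ℚ)) (c : ℕ → localPoints W (v.adicCompletion ℚ))
    (hc : IsHondaSystem κ (closureEmb (K := ℚ) (v.adicCompletion ℚ)) W (W.frobeniusTrace p) g cneg c)
    (N : ℕ) (hN : NeZero N) (f : CuspForm (Gamma0 N) 2) (ϖ : ℚ) (Lsharp Lflat : IwasawaAlgebra p)
    (hf : IsNewformOf W f) (hϖ : (ϖ : ℝ) * W.realPeriodRat = plusPeriod f)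
    (hL : IsSprungPair f p (W.frobeniusTrace p) Lsharp Lflat) (hne : chromaticL col Lsharp Lflat ≠ 0)
    (D : SharpFlatSelmerDualData W κ γ (closureEmb (K := ℚ) (v.adicCompletion ℚ)) (W.frobeniusTrace p) g c col)
    (h0 : PowerSeries.constantCoeff (chromaticL col Lsharp Lflat) = 0) :
    Module.IsTorsion (IwasawaAlgebra p) D.X := by
  obtain ⟨gen, h, hI, hι⟩ :=
    hcrux W p hX8 col κ γ hκ hγ hvar v hv g hg cneg c hc N hN f ϖ Lsharp Lflat hf hϖ hL hne D
  exact SprungLowerDivisibilityAtThreeNegative.isTorsion_of_charIdeal_eq_span_of_constantCoeff_eq_zero D.X hI hι h0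

end Summit.BirchSwinnertonDyer.BirchSwinnertonDyer.Theorems

end
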